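import Summits.Ventures.HodgeRepro2.T5HasseMinkowskiDisplays
import Summits.Ventures.HodgeRepro2.T5LandherrInvariantsIff

/-!
# Shimura's Theorem 2.2 (i) on rank-2 hermitian forms from the Hasse–Minkowski isotropy theorem and the local
quinary isotropy (cell pub-hodge-repro2, seat p3)

Tier-5 N2 support, rows N2.2.7 / N2.2.9 / N2.8.1 of route/T5-N2-route-3.md. Seat t6-p5's display
`T6.Hyp.Shimura2008_Thm2_2_i K` (Landherr's classification of rank-2 hermitian forms over the CM field `K` by the
determinant class and the signatures) is derived here, in the kernel, from file 166's two O'Meara displays —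
66:1 (Hasse–Minkowski, isotropy form) and 63:19 (quinary spaces over a local field are isotropic) — by the classical
reduction of a binary hermitian form `⟨a, b⟩` over `K = K⁺(√θ)` to the quaternary quadratic form
`⟨a, −aθ, b, −bθ⟩` over `K⁺` (`N(x + x'y) = x² − θ x'²`, file 161's `mul_star_eq_sub`; O'Meara's footnote to
Jacobson, p0191 l. 24):
* `exists_repr_of_isotropic` — O'Meara 42:10's argument («every regular isotropic quadratic space is split by a
  hyperbolic plane, hence it is universal», p0105 l. 17) for the binary hermitian form: an isotropic non-degenerate
  `⟨a, b⟩` represents every star-fixed `c` (the explicit vector `(t z₁ + u, t z₂)`, `u = (a z̄₁)⁻¹`,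
  `t = (c − a u ū)/2`);
* `exists_repr_of_isotropicDiag_five`: an isotropic vector of the quinary space `⟨a, −aθ, b, −bθ, −c⟩` over `K⁺`
  gives `z₁, z₂ ∈ K` with `a z₁ z̄₁ + b z₂ z̄₂ = c` (42:11's direction «`⟨−c⟩ ⊥ V` isotropic ⇒ `c ∈ Q(V)`», p0105
  l. 21, with the hermitian universality above when the last coordinate vanishes);
* `isCongruent_diagonal_of_repr`: `a w₁ w̄₁ + b w₂ w̄₂ = c ≠ 0` ⇒ `diag(a, b) ≅ diag(c, abc)` (the explicit basis
  `(w₁, w₂), (b w̄₂, −a w̄₁)`); `isCongruent_diagonal_mul_norm`: `diag(a, b · q q̄) ≅ diag(a, b)`;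
* `isotropicDiag_of_pos_of_neg`, `isotropicDiag_five_real`: over `ℝ` a diagonal space with a positive and a negative
  coefficient is isotropic, and the sign sums of Shimura's hypothesis force such a pair among
  `a, b, −c` (the `θ`-coefficients are never needed);
* **`shimura2008_Thm2_2_i_of_OMeara`** — `OMeara1963_66_1 K⁺ → OMeara1963_63_19 K⁺ → T6.Hyp.Shimura2008_Thm2_2_i K`:
  for totally real non-zero `c₁ c₂ c₁' c₂'` with `c₁ c₂ = c₁' c₂' · z z̄` and equal sign sums, the quinary space
  `⟨c₁', −c₁'θ, c₂', −c₂'θ, −c₁⟩` over `K⁺` is isotropic at every finite place (63:19) and every real place (the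
  sign sums), hence over `K⁺` (66:1); so `⟨c₁', c₂'⟩` represents `c₁`, `diag(c₁', c₂') ≅ diag(c₁, c₁'c₂'c₁) =
  diag(c₁, c₂ · q q̄) ≅ diag(c₁, c₂)` with `q = c₁/z`, and file 157's bridge gives the isometry of the `pairForm`s.
With file 167 (the Hasse norm theorem from 66:1) and file 165, `GrossBH2021_Thm3_1_uniqueness K (Fin 2)` — Landherr's
theorem in rank 2 — follows from the two O'Meara displays alone (file 169).

Mathlib + t6-p5's accepted T6N2Hyp (the display, consumed by name) + this seat's files 129 / 134 / 146 / 157 / 161 /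
163 / 166 and their imports; no new display; no device. §8(d): uses an L-value-free non-vanishing device: NO.
-/

namespace Summit.Ventures.HodgeRepro2.T5ShimuraOfHasseMinkowski

open Matrix NumberField NumberField.IsCMField IsDedekindDomain IsDedekindDomain.HeightOneSpectrum
open Summit.Ventures.HodgeRepro2.T5HasseMinkowskiDisplays Summit.Ventures.HodgeRepro2.T5HermitianDetClass
  Summit.Ventures.HodgeRepro2.T5HermitianGlobalChain Summit.Ventures.HodgeRepro2.T5GramIsometry
  Summit.Ventures.HodgeRepro2.T5GramSignature Summit.Ventures.HodgeRepro2.T5LandherrInvariants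
  Summit.Ventures.HodgeRepro2.T5FinitePlaceCM

/-! ## Binary hermitian forms `⟨a, b⟩`: universality of an isotropic form, and two explicit congruences -/

section Binary

variable {E : Type*} [Field E] [StarRing E]

/-- **An isotropic non-degenerate binary hermitian form represents every star-fixed element** (O'Meara 42:10's
argument): from `a z₁ z̄₁ + b z₂ z̄₂ = 0` with `(z₁, z₂) ≠ 0` and any star-fixed `c`, the vector
`(t z₁ + u, t z₂)` with `u = (a z̄₁)⁻¹` and `t = (c − a u ū)/2` has value `c`. -/
theorem exists_repr_of_isotropic [NeZero (2 : E)] {a b : E} (ha : star a = a)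
    (ha0 : a ≠ 0) (hb0 : b ≠ 0) {z₁ z₂ : E} (hz : ¬ (z₁ = 0 ∧ z₂ = 0))
    (hiso : a * (z₁ * star z₁) + b * (z₂ * star z₂) = 0) {c : E} (hc : star c = c) :
    ∃ w₁ w₂ : E, a * (w₁ * star w₁) + b * (w₂ * star w₂) = c := by
  have hz₁ : z₁ ≠ 0 := by
    rintro rfl
    apply hz
    refine ⟨rfl, ?_⟩
    rw [star_zero, mul_zero, mul_zero, zero_add] at hiso
    rcases mul_eq_zero.mp hiso with h | h
    · exact absurd h hb0
    · rcases mul_eq_zero.mp h with h' | h'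
      · exact h'
      · exact star_eq_zero.mp h'
  set u : E := (a * star z₁)⁻¹ with hu_def
  have hu : a * star z₁ * u = 1 := mul_inv_cancel₀ (mul_ne_zero ha0 (star_ne_zero.mpr hz₁))
  have hu' : a * z₁ * star u = 1 := by
    have := congrArg star hu
    rw [star_mul, star_mul, star_star, ha, star_one] at this
    linear_combination this
  set t : E := (c - a * (u * star u)) / 2 with ht_def
  have hst : star t = t := by
    rw [ht_def, star_div₀, star_sub, star_mul, star_mul, star_star, ha, hc, star_ofNat]
    ring
  have h2 : (2 : E) * t = c - a * (u * star u) := by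
    rw [ht_def, mul_div_cancel₀ _ (NeZero.ne (2 : E))]
  refine ⟨t * z₁ + u, t * z₂, ?_⟩
  rw [star_add, star_mul, star_mul, hst]
  linear_combination (t * t) * hiso + t * hu' + t * hu + h2

/-- **Representation gives a diagonal congruence:** `a w₁ w̄₁ + b w₂ w̄₂ = c ≠ 0` ⇒ `diag(a, b) ≅ diag(c, a b c)`,
by the basis `(w₁, w₂)`, `(b w̄₂, −a w̄₁)` (orthogonal for `⟨a, b⟩`, determinant `−c`). -/
theorem isCongruent_diagonal_of_repr {a b c : E} (ha : star a = a) (hb : star b = b) (hc0 : c ≠ 0)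
    {w₁ w₂ : E} (h : a * (w₁ * star w₁) + b * (w₂ * star w₂) = c) :
    IsCongruent (diagonal ![a, b]) (diagonal ![c, a * b * c]) := by
  refine ⟨!![w₁, b * star w₂; w₂, -(a * star w₁)], ?_, ?_⟩
  · rw [det_fin_two_of, isUnit_iff_ne_zero]
    intro h0
    apply hc0
    linear_combination -h - h0
  · ext i j
    fin_cases i <;> fin_cases j <;>
      simp [Matrix.mul_apply, Fin.sum_univ_two, Matrix.conjTranspose_apply, ha, hb]
    · linear_combination h
    · ring
    · ring
    · linear_combination (a * b) * h

/-- `diag(a, b · q q̄) ≅ diag(a, b)` for `q ≠ 0` (the basis change `diag(1, q⁻¹)`). -/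
theorem isCongruent_diagonal_mul_norm {a b q : E} (hq : q ≠ 0) :
    IsCongruent (diagonal ![a, b * (q * star q)]) (diagonal ![a, b]) := by
  refine ⟨diagonal ![1, q⁻¹], ?_, ?_⟩
  · rw [det_diagonal, Fin.prod_univ_two, isUnit_iff_ne_zero]
    simp [hq]
  · rw [diagonal_conjTranspose, diagonal_mul_diagonal, diagonal_mul_diagonal]
    congr 1
    ext i
    have hsq : star q ≠ 0 := star_ne_zero.mpr hq
    fin_cases i
    · simp
    · simp
      field_simp

end Binary

/-! ## Real places: a positive and a negative coefficient give an isotropic vector -/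

section Real

/-- Over `ℝ`, a diagonal space with a positive coefficient `a i` and a negative one `a j` is isotropic:
the vector `√(−a j) eᵢ + √(a i) eⱼ`. -/
theorem isotropicDiag_of_pos_of_neg {n : Type*} [Fintype n] [DecidableEq n] {a : n → ℝ} {i j : n}
    (hi : 0 < a i) (hj : a j < 0) : IsotropicDiag ℝ a := by
  have hij : i ≠ j := by
    rintro rfl
    exact absurd hi (not_lt.mpr hj.le)
  refine ⟨Pi.single i (Real.sqrt (-a j)) + Pi.single j (Real.sqrt (a i)), ?_, ?_⟩
  · intro h0
    have := congrFun h0 i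
    rw [Pi.add_apply, Pi.single_eq_same, Pi.single_eq_of_ne hij, add_zero, Pi.zero_apply] at this
    exact (Real.sqrt_pos.mpr (neg_pos.mpr hj)).ne' this
  · rw [Finset.sum_eq_add i j hij]
    · simp only [Pi.add_apply, Pi.single_eq_same, Pi.single_eq_of_ne hij, Pi.single_eq_of_ne hij.symm,
        add_zero, zero_add]
      rw [Real.sq_sqrt (neg_nonneg.mpr hj.le), Real.sq_sqrt hi.le]
      ring
    · intro k _ hk
      simp [Pi.single_eq_of_ne hk.1, Pi.single_eq_of_ne hk.2]
    · intro h
      exact absurd (Finset.mem_univ i) h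
    · intro h
      exact absurd (Finset.mem_univ j) h

/-- If `sign C + sign D = 2` then `C > 0`. -/
theorem pos_of_sign_add_eq_two {C D : ℝ} (h : (SignType.sign C : ℤ) + SignType.sign D = 2) : 0 < C := by
  rcases lt_trichotomy C 0 with hC | hC | hC
  · exfalso
    rw [sign_neg hC] at h
    rcases lt_trichotomy D 0 with hD | hD | hD
    · rw [sign_neg hD] at h
      norm_num at h
    · rw [hD, sign_zero] at h
      norm_num at h
    · rw [sign_pos hD] at h
      norm_num at h
  · exfalso
    rw [hC, sign_zero] at h
    rcases lt_trichotomy D 0 with hD | hD | hD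
    · rw [sign_neg hD] at h
      norm_num at h
    · rw [hD, sign_zero] at h
      norm_num at h
    · rw [sign_pos hD] at h
      norm_num at h
  · exact hC

/-- If `sign C + sign D = −2` then `C < 0`. -/
theorem neg_of_sign_add_eq_neg_two {C D : ℝ} (h : (SignType.sign C : ℤ) + SignType.sign D = -2) :
    C < 0 := by
  rcases lt_trichotomy C 0 with hC | hC | hC
  · exact hC
  · exfalso
    rw [hC, sign_zero] at h
    rcases lt_trichotomy D 0 with hD | hD | hD
    · rw [sign_neg hD] at h
      norm_num at h
    · rw [hD, sign_zero] at h
      norm_num at h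
    · rw [sign_pos hD] at h
      norm_num at h
  · exfalso
    rw [sign_pos hC] at h
    rcases lt_trichotomy D 0 with hD | hD | hD
    · rw [sign_neg hD] at h
      norm_num at h
    · rw [hD, sign_zero] at h
      norm_num at h
    · rw [sign_pos hD] at h
      norm_num at h

/-- **The real places of the quinary space:** for non-zero `A B C` with `sign C + sign D = sign A + sign B`, the
space `⟨A, −Aθ, B, −Bθ, −C⟩` over `ℝ` is isotropic — `A, B` of opposite signs, or of the same sign as `C`. -/
theorem isotropicDiag_five_real {A B C D θ : ℝ} (hA : A ≠ 0) (hB : B ≠ 0)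
    (hs : (SignType.sign C : ℤ) + SignType.sign D = SignType.sign A + SignType.sign B) :
    IsotropicDiag ℝ ![A, -(A * θ), B, -(B * θ), -C] := by
  rcases lt_or_gt_of_ne hA with hA' | hA' <;> rcases lt_or_gt_of_ne hB with hB' | hB'
  · -- `A < 0`, `B < 0`: `C < 0`, so `−C > 0` at index 4 and `A < 0` at index 0
    rw [sign_neg hA', sign_neg hB'] at hs
    have hC : C < 0 := neg_of_sign_add_eq_neg_two (by rw [hs]; norm_num)
    exact isotropicDiag_of_pos_of_neg (i := 4) (j := 0) (by simpa using hC) (by simpa using hA')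
  · -- `A < 0 < B`: indices 2 and 0
    exact isotropicDiag_of_pos_of_neg (i := 2) (j := 0) (by simpa using hB') (by simpa using hA')
  · -- `B < 0 < A`: indices 0 and 2
    exact isotropicDiag_of_pos_of_neg (i := 0) (j := 2) (by simpa using hA') (by simpa using hB')
  · -- `A > 0`, `B > 0`: `C > 0`, so `A > 0` at index 0 and `−C < 0` at index 4
    rw [sign_pos hA', sign_pos hB'] at hs
    have hC : 0 < C := pos_of_sign_add_eq_two (by rw [hs]; norm_num)
    exact isotropicDiag_of_pos_of_neg (i := 0) (j := 4) (by simpa using hA') (by simpa using hC)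

end Real

/-! ## From a global isotropic vector of the quinary space to a representation by `⟨a, b⟩` over `K` -/

section Representation

variable {K : Type*} [Field K] [NumberField K] [IsCMField K]
variable {θ : maximalRealSubfield K} {y : K}
  (hθ : algebraMap (maximalRealSubfield K) K θ = y ^ 2) (hy : complexConj K y ≠ y)

include hy in
/-- `s + t y = 0` with `s, t ∈ K⁺` forces `s = t = 0` (file 146's `linearIndependent_one_y`). -/
theorem eq_zero_of_add_mul_eq_zero {s t : maximalRealSubfield K}
    (h : algebraMap (maximalRealSubfield K) K s + algebraMap (maximalRealSubfield K) K t * y = 0) :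
    s = 0 ∧ t = 0 := by
  have hli := LinearIndependent.pair_iff.mp (linearIndependent_one_y K hy)
  refine hli s t ?_
  rw [Algebra.smul_def, Algebra.smul_def, mul_one]
  exact h

include hθ hy in
/-- **A global isotropic vector of `⟨a, −aθ, b, −bθ, −c⟩` over `K⁺` gives `z₁, z₂ ∈ K` with
`a z₁ z̄₁ + b z₂ z̄₂ = c`:** with `z₁ = x₀ + x₁ y`, `z₂ = x₂ + x₃ y` one has
`a N(z₁) + b N(z₂) = c x₄²`; divide by `x₄` when `x₄ ≠ 0`, and when `x₄ = 0` the hermitian form `⟨a, b⟩` is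
isotropic, hence represents `c` (`exists_repr_of_isotropic`). -/
theorem exists_repr_of_isotropicDiag_five {a b c : maximalRealSubfield K} (ha0 : a ≠ 0) (hb0 : b ≠ 0)
    (h : IsotropicDiag (maximalRealSubfield K) ![a, -(a * θ), b, -(b * θ), -c]) :
    ∃ w₁ w₂ : K, algebraMap (maximalRealSubfield K) K a * (w₁ * star w₁) +
      algebraMap (maximalRealSubfield K) K b * (w₂ * star w₂) = algebraMap (maximalRealSubfield K) K c := by
  obtain ⟨x, hx0, hx⟩ := h
  rw [Fin.sum_univ_five] at hx
  simp only [Matrix.cons_val_zero, Matrix.cons_val_one, Matrix.cons_val_two, Matrix.cons_val_three,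
    Matrix.cons_val_four, Matrix.head_cons, Matrix.tail_cons] at hx
  set A : K := algebraMap (maximalRealSubfield K) K a with hA
  set B : K := algebraMap (maximalRealSubfield K) K b with hB
  set z₁ : K := algebraMap (maximalRealSubfield K) K (x 0) + algebraMap (maximalRealSubfield K) K (x 1) * y
    with hz₁
  set z₂ : K := algebraMap (maximalRealSubfield K) K (x 2) + algebraMap (maximalRealSubfield K) K (x 3) * y
    with hz₂
  have hN₁ : z₁ * star z₁ = algebraMap (maximalRealSubfield K) K (x 0 ^ 2 - θ * x 1 ^ 2) :=
    mul_star_eq_sub hθ hy (x 0) (x 1)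
  have hN₂ : z₂ * star z₂ = algebraMap (maximalRealSubfield K) K (x 2 ^ 2 - θ * x 3 ^ 2) :=
    mul_star_eq_sub hθ hy (x 2) (x 3)
  have key : A * (z₁ * star z₁) + B * (z₂ * star z₂) =
      algebraMap (maximalRealSubfield K) K (c * x 4 ^ 2) := by
    rw [hN₁, hN₂, hA, hB, ← map_mul, ← map_mul, ← map_add]
    congr 1
    linear_combination hx
  by_cases h4 : x 4 = 0
  · -- the hermitian form `⟨a, b⟩` is isotropic
    rw [h4] at key
    simp only [ne_eq, OfNat.ofNat_ne_zero, not_false_eq_true, zero_pow, mul_zero, map_zero] at key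
    have hnz : ¬ (z₁ = 0 ∧ z₂ = 0) := by
      rintro ⟨h1, h2⟩
      apply hx0
      obtain ⟨h01, h11⟩ := eq_zero_of_add_mul_eq_zero hy h1
      obtain ⟨h21, h31⟩ := eq_zero_of_add_mul_eq_zero hy h2
      funext i
      fin_cases i
      · exact h01
      · exact h11
      · exact h21
      · exact h31
      · exact h4
    haveI : NeZero (2 : K) := ⟨two_ne_zero⟩
    have hsa : star A = A := complexConj_apply_eq_self K a
    have hsc : star (algebraMap (maximalRealSubfield K) K c) = algebraMap (maximalRealSubfield K) K c :=
      complexConj_apply_eq_self K c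
    have hA0 : A ≠ 0 := (map_ne_zero _).mpr ha0
    have hB0 : B ≠ 0 := (map_ne_zero _).mpr hb0
    exact exists_repr_of_isotropic hsa hA0 hB0 hnz key hsc
  · -- divide by `x₄`
    set e : K := algebraMap (maximalRealSubfield K) K (x 4) with he
    have he0 : e ≠ 0 := (map_ne_zero _).mpr h4
    have hse : star e = e := complexConj_apply_eq_self K (x 4)
    refine ⟨z₁ / e, z₂ / e, ?_⟩
    rw [star_div₀, star_div₀, hse]
    have : A * (z₁ / e * (star z₁ / e)) + B * (z₂ / e * (star z₂ / e)) =
        (A * (z₁ * star z₁) + B * (z₂ * star z₂)) / (e * e) := by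
      field_simp
    rw [this, key, he, map_mul, map_pow, sq, mul_div_cancel_right₀ _ (mul_ne_zero he0 he0)]

end Representation

/-! ## Shimura's Theorem 2.2 (i) from the two O'Meara displays -/

section Shimura

variable {K : Type*} [Field K] [NumberField K] [IsCMField K]

/-- **SHIMURA'S THEOREM 2.2 (i) ON RANK-2 FORMS FROM O'MEARA 66:1 + 63:19.** For totally real non-zero
`c₁ c₂ c₁' c₂' ∈ K` with `c₁ c₂ = c₁' c₂' · z z̄` and equal sign sums under every embedding, the quinary quadratic
space `⟨c₁', −c₁'θ, c₂', −c₂'θ, −c₁⟩` over `K⁺` is isotropic at every finite place (63:19) and at every real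
embedding (the sign sums), hence over `K⁺` (66:1); so the hermitian form `⟨c₁', c₂'⟩` represents `c₁` over `K`,
`diag(c₁', c₂') ≅ diag(c₁, c₁' c₂' c₁) = diag(c₁, c₂ · q q̄) ≅ diag(c₁, c₂)` with `q = c₁ / z`, and file 157's
bridge turns the congruence into the isometry of the `pairForm`s. -/
theorem shimura2008_Thm2_2_i_of_OMeara (hHM : OMeara1963_66_1 (maximalRealSubfield K))
    (h5 : OMeara1963_63_19 (maximalRealSubfield K)) :
    Summit.Ventures.HodgeRepro2.T6.Hyp.Shimura2008_Thm2_2_i K := by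
  intro c₁ c₂ c₁' c₂' h₁ h₂ h₁' h₂' hc₁ hc₂ hc₁' hc₂' hnorm hsign
  obtain ⟨θ, y, hθ, hy⟩ := exists_datum K
  -- the four coefficients lie in `K⁺`
  obtain ⟨a, rfl⟩ : ∃ a : maximalRealSubfield K, algebraMap (maximalRealSubfield K) K a = c₁' :=
    ⟨⟨c₁', (complexConj_eq_self_iff K c₁').mp h₁'⟩, rfl⟩
  obtain ⟨b, rfl⟩ : ∃ b : maximalRealSubfield K, algebraMap (maximalRealSubfield K) K b = c₂' :=
    ⟨⟨c₂', (complexConj_eq_self_iff K c₂').mp h₂'⟩, rfl⟩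
  obtain ⟨c, rfl⟩ : ∃ c : maximalRealSubfield K, algebraMap (maximalRealSubfield K) K c = c₁ :=
    ⟨⟨c₁, (complexConj_eq_self_iff K c₁).mp h₁⟩, rfl⟩
  obtain ⟨d, rfl⟩ : ∃ d : maximalRealSubfield K, algebraMap (maximalRealSubfield K) K d = c₂ :=
    ⟨⟨c₂, (complexConj_eq_self_iff K c₂).mp h₂⟩, rfl⟩
  have ha0 : a ≠ 0 := fun h => hc₁' (by rw [h, map_zero])
  have hb0 : b ≠ 0 := fun h => hc₂' (by rw [h, map_zero])
  have hc0 : c ≠ 0 := fun h => hc₁ (by rw [h, map_zero])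
  have hθ0 : θ ≠ 0 := theta_ne_zero hθ hy
  -- the quinary space over `K⁺` is isotropic
  have hiso : IsotropicDiag (maximalRealSubfield K) ![a, -(a * θ), b, -(b * θ), -c] := by
    refine hHM 5 _ ?_ ?_ ?_
    · intro i
      fin_cases i
      · exact ha0
      · exact neg_ne_zero.mpr (mul_ne_zero ha0 hθ0)
      · exact hb0
      · exact neg_ne_zero.mpr (mul_ne_zero hb0 hθ0)
      · exact neg_ne_zero.mpr hc0
    · intro v
      exact h5 v 5 le_rfl _
    · intro ψ
      have hmap : (fun i => ψ (![a, -(a * θ), b, -(b * θ), -c] i)) =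
          ![ψ a, -(ψ a * ψ θ), ψ b, -(ψ b * ψ θ), -(ψ c)] := by
        ext i
        fin_cases i <;> simp
      rw [hmap]
      -- the sign sums at the embedding `φ = lift ψ` of `K`
      have hs := hsign (ComplexEmbedding.lift K (Complex.ofRealHom.comp ψ))
      simp only [ComplexEmbedding.lift_algebraMap_apply, RingHom.comp_apply, Complex.ofRealHom_eq_coe,
        Complex.ofReal_re] at hs
      exact isotropicDiag_five_real ((map_ne_zero ψ).mpr ha0) ((map_ne_zero ψ).mpr hb0) hs
  obtain ⟨w₁, w₂, hw⟩ := exists_repr_of_isotropicDiag_five hθ hy ha0 hb0 hiso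
  -- `diag(c₁', c₂') ≅ diag(c₁, c₁' c₂' c₁)`
  have h1 := isCongruent_diagonal_of_repr h₁' h₂' hc₁ hw
  -- `c₁' c₂' c₁ = c₂ · q q̄` with `q = c₁ / z`
  obtain ⟨z, hz0, hz⟩ := hnorm
  have h2 : algebraMap (maximalRealSubfield K) K a * algebraMap (maximalRealSubfield K) K b *
      algebraMap (maximalRealSubfield K) K c =
      algebraMap (maximalRealSubfield K) K d *
        ((algebraMap (maximalRealSubfield K) K c / z) * star (algebraMap (maximalRealSubfield K) K c / z)) := by
    have hsz : star z ≠ 0 := star_ne_zero.mpr hz0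
    rw [star_div₀, h₁, div_mul_div_comm, ← mul_div_assoc, eq_div_iff (mul_ne_zero hz0 hsz)]
    linear_combination (-(algebraMap (maximalRealSubfield K) K c)) * hz
  rw [h2] at h1
  exact exists_isometry_pairForm_of_isCongruent
    (h1.trans (isCongruent_diagonal_mul_norm (div_ne_zero hc₁ hz0)))

end Shimura

end Summit.Ventures.HodgeRepro2.T5ShimuraOfHasseMinkowski
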